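import Summits.ABC.IUTFork.Cor312TwoPlaceThm311
import Summits.ABC.IUTFork.Cor312NaiveProvPinnedSetting
import Summits.ABC.IUTFork.Cor312PinnedRegionsThreePins
import HarnessLib

/-!
# [IUTchIII] Cor. 3.12 — the TWO-PLACE bed, part II (REPAIR branch engine request E4): the setting with place-dependent log-shell
# inflation; the typed Corollary holds GLOBALLY while every PACKETWISE target fails at the deep place

Record file (D-0012; abc-iut cell, REPAIR branch rung LADDER-ABC:A2.RP, seat abc-iut-rp-m4; «GO rp-m4 E4 TWO-PLACE bed»,
abc-iut-rp-plan 2026-08-26T08:18:35Z (6)). TAKES NO SIDE on [IUTchIII] Cor. 3.12 or on any author; MODEL DATA only, no `Prop` fact,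
nothing asserted. Over part I's two-place model (`Cor312TwoPlaceThm311`: index `twoIndex`, full situation `twoFull p c` with the typed
Thm. 3.11, weight `c` at both places):
* §1 `twoSetting p c d`: abc-iut-w4-d026's pin-honest setting shape (objects = exponents, glue READS the object, Prop. 3.7 output
  `NaiveProv.pinSig` reading the exponent at the bad place `0`, q-pilot datum `gen`; `Cor312NaiveProvPinnedSetting`) with
  abc-iut-w4-d103's LOG-SHELL INFLATION («ρ/(Ind3) locus», `Cor312PinnedLogShell`) made PLACE-DEPENDENT: the Kummer image of the
  Θ-pilot at `(j, v)` is `B_{j²−d(v)}`, the q-pilot's is the honest `B_1`; hull frames the cylinders.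
* §2 computed: pilots `= 1`, regions, possible images (singletons), hulls, local terms, `−|log(q)| = −2c`,
  `−|log(Θ)| = −(5 − d(0) − d(1))·c`; **Statement ⟺ 3 ≤ d(0) + d(1)** (GLOBAL), **local portion at `v` ⟺ 3 ≤ 2·d(v)**,
  **Licence at `v` ⟺ 3 ≤ d(v)**; bridge hypotheses, `|log(q)| > 0`, Thm. 3.11 (ii) (b).
* §3 the cells at `d = (0, 3)` («deep place `0` without inflation, compensating place `1` with inflation 3»), `c > 0`: the typed
  **Statement HOLDS** (`two_statement`, with equality `−2c = −2c`) while AT THE DEEP PLACE the local portion FAILS (`two_local_fails_at_zero`),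
  the (xi-f) **Licence FAILS** (`two_not_licence`), Reading R3 fails, and — for EVERY pin-respecting region reading `(ρ, qK)` — the
  residual S FAILS (`two_not_S`), as does `GapH3` for every three-pin reading; packaged at `c = log p` as `two_place_witness`. So the
  (LcGlIq)/(EssGlIq) distinction ([Rpt2024-03] `paper:url-b58939b9dc8f` p. 7 l. 32–44) is EXPRESSIBLE at two places and the typed
  Corollary is satisfied there WITHOUT any placewise supplier; `Repair.CandMochizuki40.H'` is read off in the companion
  `Repair/CandMochizuki40TwoPlace` (with a two-place region operator and the three pins, part III).
HONEST SCOPE: interface/toy level (cylinders along one packet coordinate, volumes `−k·c`); no judgement on print; standard axioms.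
[claim: Mochizuki2012, status: disputed] [cite: ScholzeStix2018, §2.2 pp. 9–10]
-/

noncomputable section

open Set

namespace Summit.ABC.IUTFork.Cor312Vol.TwoPlace

open Thm311 Cor312 Cor312Vol NaiveProv PinnedWitness Literature.IUT.LogThetaLattice

/-! ## 1. The two-place setting: honest q, Θ-images inflated by `d(v)` at the place `v` -/

section Two

variable (p : ℕ) (c : ℝ) (d : twoIndex.VQ → ℕ)

/-- **THE TWO-PLACE SETTING of Cor. 3.12** (column `n = 0`; w4-d026's honest object side — lgp- and q-monoids `ExpMonoid`, objects =
exponents, Prop. 3.7 output `pinSig` reading the exponent at the bad place `0`, q-pilot datum `gen` — and GLUE READING THE OBJECT with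
abc-iut-w4-d103's log-shell inflation made place-dependent): the `(n,m)`-Kummer image of the lgp-object of exponent `k` at `(j, v)` is
`B_{k·j²−d(v)}`; the image of the `△`-object of exponent `k` is `B_k` at `j ≠ 0` (`B_0` at the unused label `0`); hull frames the
cylinders. MODEL DATA. [claim: Mochizuki2012, status: disputed] -/
def twoSetting : Setting (situationW p (fun _ => c) (thetaVec1 (T := twoIndex) p)) where
  n := 0
  HT := ℤ × ℤ
  LogLink := fun _ _ => Unit
  IsFull := fun _ => True
  lattice :=
    { theater := fun n m => (n, m)
      distinct := fun p q h => by simpa using h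
      logLink := fun _ _ => ()
      logLink_full := fun _ _ => trivial }
  Frd := Unit
  IsoF := fun _ _ => Unit
  Ob := fun _ => ℤ
  realify := id
  Strip := Unit
  IsoS := fun _ _ => Unit
  M := fun _ _ => ExpMonoid
  sig := NaiveProv.pinSig (T := twoIndex) 0 trivial
  split := { Msplit := fun _ _ => ⊤, exists_gen := fun _ _ => ⟨⟨gen, trivial⟩, top_gen_isGenerator⟩ }
  ObΔ := ℤ
  N := fun _ _ => ExpMonoid
  qData :=
    { q := fun _ _ => gen
      q_gen := fun _ _ => gen_isGenerator
      objOf := fun x => (expOf (x 0 trivial) : ℤ) }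
  frame := fun j vQ => pFrame p j vQ
  hul_adm := fun _ _ _ hH => by obtain ⟨k, rfl⟩ := hH; exact ⟨k, rfl⟩
  thetaRegionOf := fun _ k j vQ => pBall p j vQ (k * jsq j - d vQ)
  qRegionOf := fun k j vQ => if j = 0 then pBall p j vQ 0 else pBall p j vQ k
  qRegion_mem := fun j _ => by
    by_cases h : j = 0
    · exact ⟨0, by rw [if_pos h]⟩
    · exact ⟨_, by rw [if_neg h]⟩
  qSupport_finite := fun _ => Set.toFinite _

/-! ## 2. The pilots, regions, volumes, the Statement and the Licence, COMPUTED -/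

variable [hp : Fact p.Prime]

omit hp in
/-- The Θ-pilot object is the lgp-object of exponent `1` (any generator up to torsion has exponent `1`, w4-d101). [folklore] -/
theorem two_thetaPilot : (twoSetting p c d).thetaPilot = (1 : ℤ) :=
  congrArg (Nat.cast : ℕ → ℤ)
    (expOf_eq_one_of_isGenerator_top (Classical.choose_spec ((twoSetting p c d).split.exists_gen 0 trivial)))

omit hp in
/-- The q-pilot object is the `△`-object of exponent `1`. [folklore] -/
theorem two_qPilot : (twoSetting p c d).qPilot = (1 : ℤ) := rfl

omit hp in
/-- The `(n,m)`-Kummer image of the Θ-pilot at `(j, v)` is the INFLATED cylinder `B_{j²−d(v)}`. [folklore] -/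
theorem two_thetaRegion (m : ℤ) (j : twoIndex.Label) (vQ : twoIndex.VQ) :
    (twoSetting p c d).thetaRegion m j vQ = pBall p j vQ (jsq j - d vQ) := by
  unfold Setting.thetaRegion
  rw [two_thetaPilot]
  show pBall p j vQ ((1 : ℤ) * jsq j - d vQ) = _
  rw [one_mul]

omit hp in
/-- The (Ind3)-enlarged region is `B_{j²−d(v)}`. [folklore] -/
theorem two_thetaRegion3 (j : twoIndex.Label) (vQ : twoIndex.VQ) :
    (twoSetting p c d).thetaRegion3 j vQ = pBall p j vQ (jsq j - d vQ) := by
  show (⋃ m : ℤ, (twoSetting p c d).thetaRegion m j vQ) = _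
  simp_rw [two_thetaRegion]
  exact Set.iUnion_const _

omit hp in
/-- The q-pilot's image at a nonzero label is the HONEST `B_1` at every place. [folklore] -/
theorem two_qRegion {j : twoIndex.Label} (hj : j ≠ 0) (vQ : twoIndex.VQ) : (twoSetting p c d).qRegion j vQ = pBall p j vQ 1 := by
  unfold Setting.qRegion
  rw [two_qPilot]
  show (if j = 0 then pBall p j vQ 0 else pBall p j vQ (1 : ℤ)) = _
  rw [if_neg hj]

omit hp in
/-- The possible images are the singleton `{B_{j²−d(v)}}` (the (Ind1),(Ind2)-group acts by signs and fixes cylinders). [folklore] -/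
theorem two_possibleImages (j : twoIndex.Label) (vQ : twoIndex.VQ) :
    (twoSetting p c d).possibleImages j vQ = {pBall p j vQ (jsq j - d vQ)} := by
  ext U
  constructor
  · rintro ⟨Φ, hΦ, rfl⟩
    rw [two_thetaRegion3, Set.mem_singleton_iff]
    exact image_pBall_of_mem_closure p hΦ j vQ _
  · rintro rfl
    rw [← two_thetaRegion3]
    exact (twoSetting p c d).thetaRegion3_mem_possibleImages j vQ

/-- The packet hull is `B_{j²−d(v)}` and is defined. [folklore] -/
theorem two_thetaHull (j : twoIndex.Label) (vQ : twoIndex.VQ) :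
    (twoSetting p c d).thetaHull j vQ = pBall p j vQ (jsq j - d vQ) ∧ (twoSetting p c d).HullDefined j vQ := by
  have hU : ⋃₀ (twoSetting p c d).possibleImages j vQ = pBall p j vQ (jsq j - d vQ) := by
    rw [two_possibleImages, Set.sUnion_singleton]
  refine ⟨?_, ?_⟩
  · unfold Setting.thetaHull; rw [hU]; exact pFrame_hull_pBall p j vQ _
  · unfold Setting.HullDefined; rw [hU]; exact pFrame_bounded_hasHull p j vQ _

/-- The local Θ-term at `(j, v)` is `−(j²−d(v))·c`. [folklore] -/
theorem two_thetaLocal (j : twoIndex.Label) (vQ : twoIndex.VQ) :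
    (twoSetting p c d).thetaLocal j vQ = ((-((jsq j - d vQ : ℤ) : ℝ) * c : ℝ) : WithTop ℝ) := by
  unfold Setting.thetaLocal
  rw [if_pos (two_thetaHull p c d j vQ).2, (two_thetaHull p c d j vQ).1]
  show ((volW p (fun _ => c) j vQ (pBall p j vQ (jsq j - d vQ)) : ℝ) : WithTop ℝ) = _
  rw [volW_pBall]

/-- The local q-term at a nonzero label is `−c` at every place. [folklore] -/
theorem two_qLocal (i : Fin twoIndex.lstar) (vQ : twoIndex.VQ) : (twoSetting p c d).qLocal (Setting.labelSucc i) vQ = -c := by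
  show volW p (fun _ => c) _ vQ ((twoSetting p c d).qRegion (Setting.labelSucc i) vQ) = _
  rw [two_qRegion p c d (Setting.labelSucc_ne_zero i), volW_pBall]
  push_cast
  ring

/-- «`−|log(Θ)|` is finite». [folklore] -/
theorem two_thetaFinite : (twoSetting p c d).ThetaFinite :=
  ⟨fun i vQ => by rw [two_thetaLocal]; exact WithTop.coe_ne_top, fun _ => Set.toFinite _⟩

omit hp in
/-- Procession-normalization over the two labels of `𝔽_l^⋇` is the plain average. [folklore] -/
theorem pn_two (f : Fin twoIndex.lstar → ℝ) : processionNormalized f = (f 0 + f 1) / 2 := by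
  unfold processionNormalized
  rw [Fin.sum_univ_two]
  show (f 0 + f 1) / ((2 : ℕ) : ℝ) = _
  norm_num

omit hp in
/-- The two labels of `𝔽_l^⋇`: `j = 1, 2` with `j² = 1, 4`. [folklore] -/
theorem two_jsq : jsq (T := twoIndex) (Setting.labelSucc (T := twoIndex) 0) = 1 ∧
    jsq (T := twoIndex) (Setting.labelSucc (T := twoIndex) 1) = 4 := by
  decide

/-- **`−|log(q)| = −2c`** (two places, `−c` each, averaged over the labels). [folklore] -/
theorem two_negLogQ : (twoSetting p c d).negLogQ = -2 * c := by
  unfold Setting.negLogQ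
  have h : (fun i : Fin twoIndex.lstar => ∑ᶠ vQ : twoIndex.VQ, (twoSetting p c d).qLocal (Setting.labelSucc i) vQ) =
      fun _ => -2 * c := by
    funext i
    simp_rw [two_qLocal]
    rw [finsum_eq_sum_of_fintype, Fin.sum_univ_two]
    ring
  rw [h, processionNormalized_const (by decide)]

/-- **`−|log(Θ)| = −(5 − d(0) − d(1))·c`** (at each label `j`, the two places give `−(j²−d(0))c − (j²−d(1))c`; average over `j = 1, 2`).
[folklore] -/
theorem two_negLogTheta : (twoSetting p c d).negLogTheta = ((-(5 - (d 0 : ℝ) - (d 1 : ℝ)) * c : ℝ) : WithTop ℝ) := by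
  rw [(twoSetting p c d).negLogTheta_eq_of_thetaFinite (two_thetaFinite p c d)]
  congr 1
  have h : (fun i : Fin twoIndex.lstar => ∑ᶠ vQ : twoIndex.VQ, ((twoSetting p c d).thetaLocal (Setting.labelSucc i) vQ).untopD 0) =
      fun i : Fin twoIndex.lstar =>
        -((2 * jsq (T := twoIndex) (Setting.labelSucc (T := twoIndex) i) - d 0 - d 1 : ℤ) : ℝ) * c := by
    funext i
    simp only [two_thetaLocal, WithTop.untopD_coe]
    rw [finsum_eq_sum_of_fintype, Fin.sum_univ_two]
    push_cast
    ring
  rw [h, pn_two, two_jsq.1, two_jsq.2]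
  push_cast
  ring

/-- **The typed Corollary 3.12 at the two-place setting IS the GLOBAL inequality `3 ≤ d(0) + d(1)`** (total inflation against total
height `1 + 1`), for `c > 0`. [folklore] -/
theorem two_statement_iff (hc : 0 < c) : Summit.ABC.IUTFork.Cor312.Setting.Statement (twoSetting p c d) ↔ 3 ≤ d 0 + d 1 := by
  unfold Setting.Statement
  rw [two_negLogTheta, two_negLogQ, WithTop.coe_le_coe]
  constructor
  · rintro ⟨-, h⟩
    have h' : (3 : ℝ) ≤ (d 0 : ℝ) + (d 1 : ℝ) := by nlinarith
    exact_mod_cast h'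
  · intro h
    refine ⟨WithTop.coe_ne_top, ?_⟩
    have h' : (3 : ℝ) ≤ (d 0 : ℝ) + (d 1 : ℝ) := by exact_mod_cast h
    nlinarith

/-- The procession-normalized q-term AT ONE PLACE is `−c`. [folklore] -/
theorem two_localQ (vQ : twoIndex.VQ) :
    processionNormalized (fun i : Fin twoIndex.lstar => (twoSetting p c d).qLocal (Setting.labelSucc i) vQ) = -c := by
  have hq : (fun i : Fin twoIndex.lstar => (twoSetting p c d).qLocal (Setting.labelSucc i) vQ) = fun _ => -c := by
    funext i; exact two_qLocal p c d i vQ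
  rw [hq, processionNormalized_const (by decide)]

/-- The procession-normalized hull term AT ONE PLACE `v` is `−(5/2 − d(v))·c`. [folklore] -/
theorem two_localTheta (vQ : twoIndex.VQ) :
    processionNormalized (fun i : Fin twoIndex.lstar => ((twoSetting p c d).thetaLocal (Setting.labelSucc i) vQ).untopD 0) =
      -((5 : ℝ) / 2 - d vQ) * c := by
  have ht : (fun i : Fin twoIndex.lstar => ((twoSetting p c d).thetaLocal (Setting.labelSucc i) vQ).untopD 0) =
      fun i => -((jsq (T := twoIndex) (Setting.labelSucc (T := twoIndex) i) - d vQ : ℤ) : ℝ) * c := by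
    funext i; simp only [two_thetaLocal, WithTop.untopD_coe]
  rw [ht, pn_two, two_jsq.1, two_jsq.2]
  push_cast
  ring

/-- **The LOCAL PORTION at the place `v`** (procession-normalized q-term vs hull term at `v` alone) **IS `3 ≤ 2·d(v)`**, for `c > 0` —
abc-iut-w4-d103's one-place profile `shell_statement_iff`, now one place of two. [folklore] -/
theorem two_local_iff (hc : 0 < c) (vQ : twoIndex.VQ) :
    processionNormalized (fun i : Fin twoIndex.lstar => (twoSetting p c d).qLocal (Setting.labelSucc i) vQ) ≤
        processionNormalized (fun i : Fin twoIndex.lstar => ((twoSetting p c d).thetaLocal (Setting.labelSucc i) vQ).untopD 0) ↔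
      3 ≤ 2 * d vQ := by
  rw [two_localQ, two_localTheta]
  constructor
  · intro h
    have h' : (3 : ℝ) ≤ 2 * (d vQ : ℝ) := by nlinarith
    exact_mod_cast h'
  · intro h
    have h' : (3 : ℝ) ≤ 2 * (d vQ : ℝ) := by exact_mod_cast h
    nlinarith

omit hp in
/-- `j² ≤ 4` on `𝔽_l^⋇ = {1, 2}`. [folklore] -/
theorem two_jsq_le (i : Fin twoIndex.lstar) : jsq (T := twoIndex) (Setting.labelSucc (T := twoIndex) i) ≤ 4 := by
  revert i
  decide

/-- **The (xi-f) LICENCE AT THE PLACE `v` IS `3 ≤ d(v)`** (`B_1 ⊆ B_{4−d(v)}` at label `2`). [folklore] -/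
theorem two_licenceAt_iff (vQ : twoIndex.VQ) :
    (∀ i : Fin twoIndex.lstar, (twoSetting p c d).qRegion (Setting.labelSucc i) vQ ⊆ (twoSetting p c d).thetaHull (Setting.labelSucc i) vQ) ↔
      3 ≤ d vQ := by
  constructor
  · intro h
    have h2 := h 1
    rw [(two_thetaHull p c d _ vQ).1, two_jsq.2, two_qRegion p c d (Setting.labelSucc_ne_zero _), pBall_subset_iff] at h2
    omega
  · intro hd i
    rw [(two_thetaHull p c d _ vQ).1, two_qRegion p c d (Setting.labelSucc_ne_zero _)]
    refine pBall_mono p _ vQ ?_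
    have := two_jsq_le i
    omega

/-- `μ` is monotone on cylinders at every place (`0 ≤ c`). [folklore] -/
theorem volW_const_mono (hc : 0 ≤ c) {j : twoIndex.Label} {vQ : twoIndex.VQ} {k k' : ℤ}
    (h : pBall p j vQ k ⊆ pBall p j vQ k') :
    volW p (fun _ : twoIndex.VQ => c) j vQ (pBall p j vQ k) ≤ volW p (fun _ : twoIndex.VQ => c) j vQ (pBall p j vQ k') :=
  ballVol_mono p c hc h

/-- **The bridge hypotheses HOLD** at the two-place setting (`0 ≤ c`): monotone log-volume on cylinders, admissible (cylinder) possible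
images with finitely supported volumes, nonempty hull-sets and Θ-images, «−|log(Θ)| ∈ ℝ». [folklore] -/
theorem two_bridgeHyps (hc : 0 ≤ c) : BridgeHyps (twoSetting p c d) where
  mono := by
    rintro i vQ A B ⟨k, rfl⟩ ⟨k', rfl⟩ hAB
    exact volW_const_mono p c hc hAB
  image_adm := fun i vQ U hU => ⟨jsq _ - d vQ, by rw [two_possibleImages, Set.mem_singleton_iff] at hU; exact hU⟩
  image_fin := fun _ => Set.toFinite _
  hul_nonempty := fun j vQ H hH => by obtain ⟨k, rfl⟩ := hH; exact ⟨0, zero_mem_pBall p j vQ k⟩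
  theta_nonempty := fun i vQ => by rw [two_thetaRegion3]; exact ⟨0, zero_mem_pBall p _ vQ _⟩
  finite := two_thetaFinite p c d

/-- `|log(q)| > 0` (for `c > 0`). [folklore] -/
theorem two_absLogQPos (hc : 0 < c) : (twoSetting p c d).AbsLogQPos := by
  show (twoSetting p c d).negLogQ < 0
  rw [two_negLogQ]
  linarith

/-- Thm. 3.11 (ii) (b) for every column of the two-place model (from the typed Theorem 3.11). [folklore] -/
theorem two_kummerB (n : ℤ) : ((twoFull p c).col n).KummerB ((twoFull p c).D n) :=
  GluedMonoids.kummerB_of_statement (twoFull p c) (twoFull_statement p c) n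

/-! ## 3. The cells at `d = (0, 3)`: deep place `0`, compensating place `1` -/

/-- The inflation profile of record: none at the place `0`, exponent `3` at the place `1`. MODEL DATA. [folklore] -/
def depth : twoIndex.VQ → ℕ := fun vQ => 3 * (vQ : ℕ)

omit hp in
/-- `d(0) = 0`, `d(1) = 3`. [folklore] -/
theorem depth_val : depth 0 = 0 ∧ depth 1 = 3 := by decide

/-- **The typed Corollary 3.12 HOLDS at the two-place setting of record** (`3 ≤ 0 + 3`: `−|log(q)| = −2c = −|log(Θ)|`). [folklore] -/
theorem two_statement (hc : 0 < c) : Summit.ABC.IUTFork.Cor312.Setting.Statement (twoSetting p c depth) :=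
  (two_statement_iff p c depth hc).2 (by rw [depth_val.1, depth_val.2])

/-- **… while the LOCAL PORTION AT THE DEEP PLACE `0` FAILS** (`−c ≤ −(5/2)c` is false): the (EssGlIq) situation. [folklore] -/
theorem two_local_fails_at_zero (hc : 0 < c) :
    ¬ (processionNormalized (fun i : Fin twoIndex.lstar => (twoSetting p c depth).qLocal (Setting.labelSucc i) 0) ≤
        processionNormalized (fun i : Fin twoIndex.lstar => ((twoSetting p c depth).thetaLocal (Setting.labelSucc i) 0).untopD 0)) := by
  rw [two_local_iff p c depth hc, depth_val.1]
  decide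

/-- … and holds at the compensating place `1` (`3 ≤ 6`). [folklore] -/
theorem two_local_holds_at_one (hc : 0 < c) :
    processionNormalized (fun i : Fin twoIndex.lstar => (twoSetting p c depth).qLocal (Setting.labelSucc i) 1) ≤
      processionNormalized (fun i : Fin twoIndex.lstar => ((twoSetting p c depth).thetaLocal (Setting.labelSucc i) 1).untopD 0) := by
  rw [two_local_iff p c depth hc, depth_val.2]
  decide

/-- **The (xi-f) LICENCE FAILS** (at the deep place: `B_1 ⊄ B_4` at label `2`). [folklore] -/
theorem two_not_licence : ¬ Thm311ToCor312.Licence (twoSetting p c depth) := fun h => by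
  have h0 := (two_licenceAt_iff p c depth 0).1 fun i => h i 0
  rw [depth_val.1] at h0
  exact absurd h0 (by decide)

/-- … hence Reading R3 («the q-pilot region IS a possible image») fails. [folklore] -/
theorem two_not_reading3 :
    ¬ ∀ (i : Fin twoIndex.lstar) (vQ : twoIndex.VQ),
      (twoSetting p c depth).qRegion (Setting.labelSucc i) vQ ∈ (twoSetting p c depth).possibleImages (Setting.labelSucc i) vQ :=
  fun h => two_not_licence p c (Thm311ToCor312.licence_of_qRegion_mem_possibleImages _ h)

/-- **… hence, for EVERY pin-respecting region reading `(ρ, qK)`, the residual S FAILS** (S ⟹ R3 under the two region pins and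
Thm. 3.11 (ii) (b), abc-iut-w5-d230's `reading3_iff_pilotKummerIndRelated`). [folklore] -/
theorem two_not_S
    (ρ : (∀ v : twoIndex.V, v ∈ twoIndex.Vbad → Set ((signShells twoIndex).StarPacket v)) →
      ∀ (j : twoIndex.Label) (vQ : twoIndex.VQ), Set ((signShells twoIndex).Packet j vQ))
    (qK : ∀ v : twoIndex.V, v ∈ twoIndex.Vbad → Set ((signShells twoIndex).StarPacket v))
    (hpin : PinnedRegions (twoFull p c).toLatticeSituation (twoSetting p c depth) ρ qK) :
    ¬ PilotKummerIndRelated (twoFull p c).toLatticeSituation (twoSetting p c depth) ρ qK := fun hS =>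
  two_not_reading3 p c fun i vQ =>
    (reading3_iff_pilotKummerIndRelated (twoFull p c).toLatticeSituation (twoSetting p c depth) ρ qK (two_kummerB p c _) hpin).2
      hS (Setting.labelSucc i) vQ

/-- … and, for every three-pin reading, the hull-level gap `GapH3` FAILS. [folklore] -/
theorem two_not_gapH3
    (ρ : (∀ v : twoIndex.V, v ∈ twoIndex.Vbad → Set ((signShells twoIndex).StarPacket v)) →
      ∀ (j : twoIndex.Label) (vQ : twoIndex.VQ), Set ((signShells twoIndex).Packet j vQ))
    (qK : ∀ v : twoIndex.V, v ∈ twoIndex.Vbad → Set ((signShells twoIndex).StarPacket v))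
    (hpin : PinnedRegions3 (twoFull p c).toLatticeSituation (twoSetting p c depth) ρ qK) :
    ¬ GapH3 (twoFull p c).toLatticeSituation (twoSetting p c depth) ρ qK := fun h => two_not_licence p c (h hpin)

/-- **THE TWO-PLACE WITNESS (engine request E4 of the REPAIR branch), at `c = log p`:** a full situation satisfying the typed
Theorem 3.11 (i) ∧ (ii) ∧ (iii) and a Cor.-3.12 setting over the two-place index with the bridge hypotheses and `|log(q)| > 0` where the
typed Statement HOLDS, the local portion FAILS at the place `0` (and holds at the place `1`), the (xi-f) Licence and Reading R3 FAIL, and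
the residual S FAILS for every pin-respecting region reading — the typed Corollary satisfied at two places WITHOUT any placewise
supplier ((EssGlIq)'s «essentially global», made visible). No judgement on print. [folklore] -/
theorem two_place_witness :
    (twoFull p (Real.log p)).Statement ∧ BridgeHyps (twoSetting p (Real.log p) depth) ∧ (twoSetting p (Real.log p) depth).AbsLogQPos ∧
      Summit.ABC.IUTFork.Cor312.Setting.Statement (twoSetting p (Real.log p) depth) ∧
      ¬ (processionNormalized (fun i : Fin twoIndex.lstar => (twoSetting p (Real.log p) depth).qLocal (Setting.labelSucc i) 0) ≤
          processionNormalized (fun i : Fin twoIndex.lstar =>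
            ((twoSetting p (Real.log p) depth).thetaLocal (Setting.labelSucc i) 0).untopD 0)) ∧
      ¬ Thm311ToCor312.Licence (twoSetting p (Real.log p) depth) ∧
      (∀ ρ qK, PinnedRegions (twoFull p (Real.log p)).toLatticeSituation (twoSetting p (Real.log p) depth) ρ qK →
        ¬ PilotKummerIndRelated (twoFull p (Real.log p)).toLatticeSituation (twoSetting p (Real.log p) depth) ρ qK) :=
  have hc : 0 < Real.log p := Real.log_pos (by exact_mod_cast hp.out.one_lt)
  ⟨twoFull_statement p _, two_bridgeHyps p _ depth hc.le, two_absLogQPos p _ depth hc, two_statement p _ hc,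
    two_local_fails_at_zero p _ hc, two_not_licence p _, fun ρ qK hpin => two_not_S p _ ρ qK hpin⟩

end Two

end Summit.ABC.IUTFork.Cor312Vol.TwoPlace

end
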